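import Summits.CriticalPhenomena.Ising3DConformalLimit.Theorems.SynchronousCouplingRotationJoiningIsotropyNearGeneric
import Summits.CriticalPhenomena.Ising3DConformalLimit.Theorems.SynchronousCouplingRotationJoiningIsotropyTwoPointSums
import Summits.CriticalPhenomena.Ising3DConformalLimit.Theorems.SynchronousCouplingRotationJoiningIsotropyFarField
import Summits.CriticalPhenomena.Ising3DConformalLimit.Theorems.SynchronousCouplingRotationJoiningIsotropyLimit
import Summits.CriticalPhenomena.Ising3DConformalLimit.Theorems.SynchronousCouplingRotationJoiningTwoPointToolkit
import Summits.CriticalPhenomena.Ising3DConformalLimit.Theorems.SynchronousCouplingRotationJoiningNewmanBlocks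
import Literature.Probability.LatticeModels.CriticalUrsellFourSign
import HarnessLib

/-!
# Route `SynchronousCoupling`, crux `RotationJoining` (stmt-CriticalPhenomena-18763), line `SketchIdeator2` (reshape 2) —
# (A1): the rescaled smeared `k`-point correlators over tilted and over axis cells are asymptotically equal

* `nearSums_small`: for every `η > 0` there is `r > 0` such that, from some `n` on, the rescaled smeared correlator
  `(ρ_pin(1/n)/n³)ᵏ Σ G_k` over the configurations of `∏ₗ axisCell n wₗ` (resp. `∏ₗ tiltCell n m wₗ`) having two
  `rn`-close points (resp. `ψ`-images) is `≤ η` (from `nearSum_generic_le`, the row-sum bounds of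
  `…IsotropyTwoPointSums` and `ρ_pin(1/n)² V(n) ≤ B n⁶`);
* `smearedDiff_tendsto` (registered sub-goal, (A1)):
  `(ρ_pin(1/n)/n³)ᵏ (Σ_{y ∈ ∏ₗ axisCell n wₗ} ⟨∏ₗ σ_{ψ⁻¹(yₗ)}⟩ − Σ_y ⟨∏ₗ σ_{yₗ}⟩) → 0` — near part by `nearSums_small`, far
  part termwise by `farField_tilt_sub_axis` (pinned scaling limit + its rotation invariance + `‖ψ⁻¹(w)/n − R(w/n)‖ ≤ 2/n`).
References: G. Kozma, arXiv:0512511 (the commensurate rotation `ψ = ⌊A·/3⌋`); M. Aizenman, H. Duminil-Copin,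
Ann. Math. 194 (2021). No definitions, no sorry.
-/

noncomputable section

namespace Summit.CriticalPhenomena.Ising3DConformalLimit.Cruxes.RotationJoining.RateSplitting

open MeasureTheory Filter Literature.Probability.LatticeModels Finset
open scoped BigOperators Topology
open Summit.CriticalPhenomena.Ising3DConformalLimit.MoebiusLimitExistsOnlyInteraction (rhoPin rhoPin_sq)
open Summit.CriticalPhenomena.Ising3DConformalLimit.Cruxes.ExistsScaleCovariantLimit.MonotoneBlockingPort
  (blockCov blockCov_zero_pos BlockTwoLimits stub_twoPointScaling_of_lattice stub_blockCovAlgebra stub_blockCovTwoPointBounds)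
open Summit.CriticalPhenomena.Ising3DConformalLimit.Theses

/-! ### The near-field sums are uniformly small -/

/-- **The near-field parts are uniformly small** (both cell shapes). See the module docstring. The hypothesis `hBV` is the
boundedness of `ρ_pin(1/n)² V(n)/n⁶` (`TwoPointScaling` (i)). [cite: AizenmanDuminilCopinAnnals2021, arXiv:1912.07973 §6.3] -/
theorem nearSums_small (hTK : TwoPointToolkit) (hBS : BallSums) (hNB : NewmanBlocks)
    (hBV : ∃ BV : ℝ, ∀ n : ℕ, 1 ≤ n → rhoPin (1 / (n : ℝ)) ^ 2 * blockCov n 0 ≤ BV * (n : ℝ) ^ 6)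
    (k m : ℕ) (w : Fin k → (Fin 3 → ℤ)) (hw : ∀ l i, |w l i| ≤ m) (η : ℝ) (hη : 0 < η) :
    ∃ r : ℝ, 0 < r ∧ ∃ N : ℕ, 1 ≤ N ∧ ∀ n : ℕ, N ≤ n →
      (rhoPin (1 / (n : ℝ)) / (n : ℝ) ^ 3) ^ k *
          ∑ y ∈ (Fintype.piFinset (fun l => axisCell n (w l))).filter
            (fun y => ∃ a b, a ≠ b ∧ ∀ i, |((y a i : ℤ) : ℝ) - ((y b i : ℤ) : ℝ)| < r * n), criticalCorr 3 k y ≤ η ∧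
      (rhoPin (1 / (n : ℝ)) / (n : ℝ) ^ 3) ^ k *
          ∑ y ∈ (Fintype.piFinset (fun l => tiltCell n m (w l))).filter
            (fun y => ∃ a b, a ≠ b ∧ ∀ i, |((psi (y a) i : ℤ) : ℝ) - ((psi (y b) i : ℤ) : ℝ)| < r * n),
            criticalCorr 3 k y ≤ η := by
  classical
  -- odd `k`: every term vanishes
  rcases Nat.even_or_odd k with ⟨p, hp⟩ | hodd
  swap
  · refine ⟨1, one_pos, 1, le_rfl, fun n _ => ?_⟩
    have hz : ∀ y : Fin k → Site 3, criticalCorr 3 k y = 0 := fun y =>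
      criticalCorr_eq_zero_of_odd (d := 3) le_rfl hodd y
    simp only [hz, Finset.sum_const_zero, mul_zero]
    exact ⟨hη.le, hη.le⟩
  -- `k = 0`: no pair of indices
  rcases Nat.eq_zero_or_pos p with hp0 | hp0
  · subst hp0
    simp only [add_zero] at hp
    subst hp
    refine ⟨1, one_pos, 1, le_rfl, fun n _ => ?_⟩
    have z1 : ∑ y ∈ (Fintype.piFinset (fun l => axisCell n (w l))).filter
        (fun y => ∃ a b, a ≠ b ∧ ∀ i, |((y a i : ℤ) : ℝ) - ((y b i : ℤ) : ℝ)| < 1 * n), criticalCorr 3 (0 + 0) y = 0 :=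
      Finset.sum_eq_zero fun y hy => by
        obtain ⟨a, -⟩ := (Finset.mem_filter.1 hy).2; exact Fin.elim0 a
    have z2 : ∑ y ∈ (Fintype.piFinset (fun l => tiltCell n m (w l))).filter
        (fun y => ∃ a b, a ≠ b ∧ ∀ i, |((psi (y a) i : ℤ) : ℝ) - ((psi (y b) i : ℤ) : ℝ)| < 1 * n),
        criticalCorr 3 (0 + 0) y = 0 :=
      Finset.sum_eq_zero fun y hy => by
        obtain ⟨a, -⟩ := (Finset.mem_filter.1 hy).2; exact Fin.elim0 a
    rw [z1, z2, mul_zero]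
    exact ⟨hη.le, hη.le⟩
  obtain ⟨q, rfl⟩ : ∃ q, p = q + 1 := ⟨p - 1, by omega⟩
  have hk2 : k = 2 * (q + 1) := by rw [hp]; ring
  have hkp : k - 2 = 2 * q := by omega
  -- constants
  obtain ⟨A_U, hAU0, L_U, hLU, hU⟩ := rowSum_window_le hBS (2 * (m + 1))
  obtain ⟨A', hA'0, L₀', hL₀', hnear⟩ := rowSum_near_le hBS hTK
  obtain ⟨BV, hBV⟩ := hBV
  set BV' : ℝ := max BV 1 with hBV'
  have hBV'0 : 0 ≤ BV' := le_trans zero_le_one (le_max_right _ _)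
  set Nk : ℝ := ((2 * (k - 2)).factorial : ℝ) / (2 ^ (k - 2) * (k - 2).factorial) with hNk
  have hNk0 : 0 ≤ Nk := by positivity
  set C₁ : ℝ := 3 * A' ^ 2 + 686 * A_U ^ 2 with hC₁
  have hC₁0 : 0 ≤ C₁ := by positivity
  set D : ℝ := (k : ℝ) ^ 2 * (Real.sqrt C₁ * (Real.sqrt Nk * (A_U ^ q * BV' ^ (q + 1)))) with hD
  have hD0 : 0 ≤ D := by positivity
  set r : ℝ := min (1 / 4) ((η / (D + 1)) ^ 2) with hr
  have hr0 : 0 < r := lt_min (by norm_num) (by positivity)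
  have hr4 : r ≤ 1 / 4 := min_le_left _ _
  have hr1 : r ≤ 1 := hr4.trans (by norm_num)
  have hrD : D * Real.sqrt r ≤ η := by
    have h1 : Real.sqrt r ≤ η / (D + 1) := by
      rw [Real.sqrt_le_left (by positivity)]
      exact min_le_right _ _
    calc D * Real.sqrt r ≤ D * (η / (D + 1)) := mul_le_mul_of_nonneg_left h1 hD0
      _ ≤ η := by
          rw [mul_div_assoc']
          rw [div_le_iff₀ (by positivity)]
          nlinarith
  -- the threshold
  obtain ⟨N₀, hN₀⟩ := exists_nat_gt (max (L₀' : ℝ) 11 / r)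
  set N : ℕ := max (max N₀ L_U) 10 with hN
  refine ⟨r, hr0, N, le_trans (by norm_num) (le_max_right _ _), fun n hn => ?_⟩
  have hnN₀ : N₀ ≤ n := le_trans ((le_max_left _ _).trans (le_max_left _ _)) hn
  have hnLU : L_U ≤ n := le_trans ((le_max_right _ _).trans (le_max_left _ _)) hn
  have hn10 : 10 ≤ n := le_trans (le_max_right _ _) hn
  have hn1 : 1 ≤ n := by omega
  have hnpos : (0:ℝ) < n := by exact_mod_cast (show 0 < n by omega)
  have hrn : max (L₀' : ℝ) 11 ≤ r * n := by
    have h1 : max (L₀' : ℝ) 11 / r < N₀ := hN₀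
    rw [div_lt_iff₀ hr0] at h1
    have h2 : (N₀ : ℝ) ≤ n := by exact_mod_cast hnN₀
    nlinarith
  have hrn11 : (11:ℝ) ≤ r * n := (le_max_right _ _).trans hrn
  have hrnL : (L₀' : ℝ) ≤ r * n := (le_max_left _ _).trans hrn
  -- the closeness radius `L'`
  set L' : ℕ := ⌊2 * r * n⌋₊ + 5 with hL'
  have hfl : (⌊2 * r * n⌋₊ : ℝ) ≤ 2 * r * n := Nat.floor_le (by positivity)
  have hL'1 : L₀' ≤ L' := by
    have : L₀' ≤ ⌊2 * r * n⌋₊ := Nat.le_floor (by nlinarith)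
    omega
  have hL'n : L' ≤ n := by
    have h1 : (⌊2 * r * n⌋₊ : ℝ) ≤ n / 2 := hfl.trans (by nlinarith)
    have h2 : (⌊2 * r * n⌋₊ : ℕ) ≤ n / 2 := by
      rw [Nat.le_div_iff_mul_le two_pos]
      have : ((⌊2 * r * n⌋₊ * 2 : ℕ) : ℝ) ≤ n := by push_cast; linarith
      exact_mod_cast this
    omega
  have hL'R : (L' : ℝ) ≤ 2 * r * n + 5 := by rw [hL']; push_cast; linarith
  have hL'3 : (L' : ℝ) ≤ 3 * r * n := by linarith
  have hL'7 : 2 * (L' : ℝ) + 1 ≤ 7 * r * n := by linarith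
  clear_value L'
  clear hfl hL'R
  -- the common quantities
  set V : ℝ := blockCov n 0 with hVdef
  have hV0 : 0 ≤ V := (blockCov_zero_pos n hn1).le
  clear_value V
  set U : ℝ := A_U * V / (n : ℝ) ^ 3 with hUdef
  have hU0' : 0 ≤ U := div_nonneg (mul_nonneg hAU0 hV0) (by positivity)
  set u : ℝ := A' * (((L' : ℝ) ^ (1 / 2 : ℝ)) * (n : ℝ) ^ (-(7 / 2 : ℝ))) * V with hudef
  have hu0' : 0 ≤ u :=
    mul_nonneg (mul_nonneg hA'0 (mul_nonneg (Real.rpow_nonneg (Nat.cast_nonneg _) _)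
      (Real.rpow_nonneg (Nat.cast_nonneg _) _))) hV0
  clear_value u
  have hn3U : (n : ℝ) ^ 3 * U = A_U * V := by rw [hUdef]; field_simp
  clear_value U
  -- the rescaling factor
  have hρ0 : 0 ≤ rhoPin (1 / (n:ℝ)) := (Real.rpow_nonneg (criticalTwoPoint_nonneg' _) _)
  set s : ℝ := rhoPin (1 / (n:ℝ)) ^ 2 / (n : ℝ) ^ 6 with hs
  have hs0 : 0 ≤ s := by positivity
  have hsV : s * V ≤ BV' := by
    have h := hBV n hn1
    rw [← hVdef] at h
    rw [hs, div_mul_eq_mul_div, div_le_iff₀ (by positivity)]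
    exact h.trans (mul_le_mul_of_nonneg_right (le_max_left _ _) (by positivity))
  have hρk : (rhoPin (1 / (n : ℝ)) / (n : ℝ) ^ 3) ^ k = s ^ (q + 1) := by
    rw [hk2, pow_mul, hs, div_pow]; ring
  clear_value s
  -- the generic estimate, for a family satisfying the three geometric hypotheses
  have key : ∀ (P : Fin k → Finset (Site 3)) (κ : Site 3 → Site 3),
      (∀ l, ((P l).card : ℝ) ≤ (n : ℝ) ^ 3) →
      (∀ x x' : Site 3, (∀ i, |((κ x i : ℤ) : ℝ) - ((κ x' i : ℤ) : ℝ)| < r * n) → ∀ i, |x i - x' i| ≤ L') →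
      (∀ (l l' : Fin k), ∀ x ∈ P l', ∀ y ∈ P l, ∀ i, |y i - x i| ≤ 2 * (2 * (m + 1)) * n) →
      (rhoPin (1 / (n : ℝ)) / (n : ℝ) ^ 3) ^ k *
          ∑ y ∈ (Fintype.piFinset P).filter
            (fun y => ∃ a b, a ≠ b ∧ ∀ i, |((κ (y a) i : ℤ) : ℝ) - ((κ (y b) i : ℤ) : ℝ)| < r * n),
            criticalCorr 3 k y ≤ η := by
    intro P κ hcardP hcloseP hwinP
    have hUP : ∀ (l l' : Fin k), ∀ x ∈ P l', ∑ y ∈ P l, criticalTwoPoint 3 (y - x) ≤ U := fun l l' x hx => by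
      have h := hU n hnLU (P l) x (fun y hy i => by exact_mod_cast hwinP l l' x hx y hy i)
      rwa [← hVdef, ← hUdef] at h
    have huP : ∀ (Q : Finset (Site 3)) (q₀ : Site 3), (∀ q ∈ Q, ∀ i, |q i - q₀ i| ≤ L') →
        ∑ q ∈ Q, criticalTwoPoint 3 (q - q₀) ≤ u := fun Q q₀ hQ => by
      have h := hnear n L' hL'1 hL'n Q q₀ hQ
      rwa [← hVdef, ← hudef] at h
    -- the algebra
    have hT : ((n : ℝ) ^ 3 * u) ^ 2 ≤ 3 * A' ^ 2 * r * V ^ 2 := by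
      rw [hudef, near_rowSum_sq (by omega) A' V]
      have h1 : (L' : ℝ) / n ≤ 3 * r := by rw [div_le_iff₀ hnpos]; linarith only [hL'3]
      have hA2 : 0 ≤ A' ^ 2 * V ^ 2 := mul_nonneg (sq_nonneg _) (sq_nonneg _)
      calc A' ^ 2 * ((L' : ℝ) / n) * V ^ 2 = ((L' : ℝ) / n) * (A' ^ 2 * V ^ 2) := by ring
        _ ≤ (3 * r) * (A' ^ 2 * V ^ 2) := mul_le_mul_of_nonneg_right h1 hA2
        _ = 3 * A' ^ 2 * r * V ^ 2 := by ring
    have hS : 2 * ((n : ℝ) ^ 3 * (2 * (L' : ℝ) + 1) ^ 3) * U ^ 2 ≤ 686 * A_U ^ 2 * r * V ^ 2 := by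
      have e : 2 * ((n : ℝ) ^ 3 * (2 * (L' : ℝ) + 1) ^ 3) * U ^ 2 =
          2 * A_U ^ 2 * V ^ 2 * ((2 * (L' : ℝ) + 1) / n) ^ 3 := by
        rw [hUdef]; field_simp
      rw [e]
      have h1 : (2 * (L' : ℝ) + 1) / n ≤ 7 * r := by rw [div_le_iff₀ hnpos]; linarith only [hL'7]
      have h0 : 0 ≤ (2 * (L' : ℝ) + 1) / n :=
        div_nonneg (add_nonneg (mul_nonneg zero_le_two (Nat.cast_nonneg _)) zero_le_one) hnpos.le
      have h2 : ((2 * (L' : ℝ) + 1) / n) ^ 3 ≤ (7 * r) ^ 3 := pow_le_pow_left₀ h0 h1 3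
      have h3 : (7 * r) ^ 3 ≤ 343 * r := by
        have hr3 : r ^ 3 ≤ r := by
          have := pow_le_pow_of_le_one hr0.le hr1 (show 1 ≤ 3 by norm_num)
          rwa [pow_one] at this
        calc (7 * r) ^ 3 = 343 * r ^ 3 := by ring
          _ ≤ 343 * r := by linarith only [hr3]
      have hAV : 0 ≤ 2 * A_U ^ 2 * V ^ 2 := mul_nonneg (mul_nonneg zero_le_two (sq_nonneg _)) (sq_nonneg _)
      calc 2 * A_U ^ 2 * V ^ 2 * ((2 * (L' : ℝ) + 1) / n) ^ 3 ≤ 2 * A_U ^ 2 * V ^ 2 * (343 * r) :=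
            mul_le_mul_of_nonneg_left (h2.trans h3) hAV
        _ = 686 * A_U ^ 2 * r * V ^ 2 := by ring
    have hsq1 : Real.sqrt (((n : ℝ) ^ 3 * u) ^ 2 + 2 * ((n : ℝ) ^ 3 * (2 * (L' : ℝ) + 1) ^ 3) * U ^ 2) ≤
        Real.sqrt C₁ * Real.sqrt r * V := by
      have hTS : ((n : ℝ) ^ 3 * u) ^ 2 + 2 * ((n : ℝ) ^ 3 * (2 * (L' : ℝ) + 1) ^ 3) * U ^ 2 ≤ C₁ * r * V ^ 2 := by
        have e : C₁ * r * V ^ 2 = 3 * A' ^ 2 * r * V ^ 2 + 686 * A_U ^ 2 * r * V ^ 2 := by rw [hC₁]; ring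
        rw [e]; exact add_le_add hT hS
      calc _ ≤ Real.sqrt (C₁ * r * V ^ 2) := Real.sqrt_le_sqrt hTS
        _ = Real.sqrt C₁ * Real.sqrt r * V := by
            rw [Real.sqrt_mul (mul_nonneg hC₁0 hr0.le) (V ^ 2), Real.sqrt_mul hC₁0 r, Real.sqrt_sq hV0]
    have hsq2 : Real.sqrt (Nk * ((n : ℝ) ^ 3 * U) ^ (k - 2)) = Real.sqrt Nk * (A_U * V) ^ q := by
      rw [hn3U, hkp, pow_mul', Real.sqrt_mul hNk0, Real.sqrt_sq (pow_nonneg (mul_nonneg hAU0 hV0) q)]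
    have hsqT0 : 0 ≤ Real.sqrt (((n : ℝ) ^ 3 * u) ^ 2 + 2 * ((n : ℝ) ^ 3 * (2 * (L' : ℝ) + 1) ^ 3) * U ^ 2) :=
      Real.sqrt_nonneg _
    have hM0 : 0 ≤ Real.sqrt Nk * (A_U * V) ^ q := mul_nonneg (Real.sqrt_nonneg _) (pow_nonneg (mul_nonneg hAU0 hV0) q)
    -- the chain (the generic estimate is introduced last: `linarith` must not see the big sums)
    have step2 : s ^ (q + 1) * ((k : ℝ) ^ 2 *
          (Real.sqrt (((n : ℝ) ^ 3 * u) ^ 2 + 2 * ((n : ℝ) ^ 3 * (2 * (L' : ℝ) + 1) ^ 3) * U ^ 2) *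
            (Real.sqrt Nk * (A_U * V) ^ q))) ≤
        s ^ (q + 1) * ((k : ℝ) ^ 2 * ((Real.sqrt C₁ * Real.sqrt r * V) * (Real.sqrt Nk * (A_U * V) ^ q))) :=
      mul_le_mul_of_nonneg_left (mul_le_mul_of_nonneg_left (mul_le_mul_of_nonneg_right hsq1 hM0) (sq_nonneg _))
        (pow_nonneg hs0 _)
    have step3 : s ^ (q + 1) * ((k : ℝ) ^ 2 * ((Real.sqrt C₁ * Real.sqrt r * V) * (Real.sqrt Nk * (A_U * V) ^ q))) =
        ((k : ℝ) ^ 2 * (Real.sqrt C₁ * (Real.sqrt Nk * A_U ^ q))) * Real.sqrt r * (s * V) ^ (q + 1) := by ring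
    have step4 : ((k : ℝ) ^ 2 * (Real.sqrt C₁ * (Real.sqrt Nk * A_U ^ q))) * Real.sqrt r * (s * V) ^ (q + 1) ≤
        ((k : ℝ) ^ 2 * (Real.sqrt C₁ * (Real.sqrt Nk * A_U ^ q))) * Real.sqrt r * BV' ^ (q + 1) :=
      mul_le_mul_of_nonneg_left (pow_le_pow_left₀ (mul_nonneg hs0 hV0) hsV (q + 1))
        (mul_nonneg (mul_nonneg (sq_nonneg _) (mul_nonneg (Real.sqrt_nonneg _)
          (mul_nonneg (Real.sqrt_nonneg _) (pow_nonneg hAU0 q)))) (Real.sqrt_nonneg _))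
    have step5 : ((k : ℝ) ^ 2 * (Real.sqrt C₁ * (Real.sqrt Nk * A_U ^ q))) * Real.sqrt r * BV' ^ (q + 1) =
        D * Real.sqrt r := by
      rw [hD]; ring
    have hgen := nearSum_generic_le hNB P κ r L' hcardP hcloseP hU0' hu0' hUP huP
    have step1 := mul_le_mul_of_nonneg_left hgen
      (pow_nonneg (div_nonneg hρ0 (pow_nonneg (Nat.cast_nonneg n) 3) : (0:ℝ) ≤ rhoPin (1 / (n : ℝ)) / (n : ℝ) ^ 3) k)
    rw [hρk, hsq2] at step1
    rw [hρk]
    refine step1.trans (step2.trans ?_)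
    rw [step3]
    refine step4.trans ?_
    rw [step5]
    exact hrD
  constructor
  · -- axis cells
    have h := key (fun l => axisCell n (w l)) id
      (fun l => by rw [TiltGeometry.card_axisCell]; push_cast; exact le_rfl)
      (fun x x' hx i => by rw [hL']; exact abs_sub_le_of_id_close hr0.le x x' hx i)
      (fun l l' x hx y hy i => by exact_mod_cast abs_sub_le_window_axis (hw l) (hw l') hx hy i)
    simpa only [id] using h
  · -- tilted cells
    exact key (fun l => tiltCell n m (w l)) psi
      (fun l => by rw [TiltGeometry.card_tiltCell (hw l)]; push_cast; exact le_rfl)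
      (fun x x' hx i => by rw [hL']; exact abs_sub_le_of_psi_close' hr0.le x x' hx i)
      (fun l l' x hx y hy i => by exact_mod_cast abs_sub_le_window_tilt hx hy i)

/-! ### (A1): the rescaled smeared difference tends to zero -/

/-- **Registered sub-goal `smearedDiff_tendsto` (A1): the rescaled smeared `k`-point correlators over tilted and over axis cells are asymptotically equal**:
`(ρ_pin(1/n)/n³)ᵏ (Σ_{y ∈ ∏ₗ axisCell n wₗ} ⟨∏ σ_{ψ⁻¹(yₗ)}⟩ − Σ_y ⟨∏σ_{yₗ}⟩) → 0`. [folklore] -/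
theorem smearedDiff_tendsto (hDJ : SynchronousCoupling.DilationJoinings) (hUR : SynchronousCoupling.UniformRegularity)
    (hBS : BallSums) (k m : ℕ) (w : Fin k → (Fin 3 → ℤ)) (hw : ∀ l i, |w l i| ≤ m) :
    Tendsto (fun n : ℕ => (rhoPin (1 / (n : ℝ)) / (n : ℝ) ^ 3) ^ k *
        ((∑ y ∈ Fintype.piFinset (fun l => axisCell n (w l)), criticalCorr 3 k (fun l => psiInv (y l))) -
          ∑ y ∈ Fintype.piFinset (fun l => axisCell n (w l)), criticalCorr 3 k y)) atTop (𝓝 0) := by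
  classical
  have hTK : TwoPointToolkit := stub_twoPointToolkit hDJ hUR
  obtain ⟨S, hS, -, -, -, hrot, hcont⟩ := isotropyLimit_of_joinings hDJ hUR
  have hBV := rhoPin_sq_blockCov_le hDJ hUR
  rw [Metric.tendsto_atTop]
  intro ε hε
  have hε4 : 0 < ε / 4 := by positivity
  obtain ⟨r, hr0, N₁, -, hnear⟩ := nearSums_small hTK hBS stub_newmanBlocks hBV k m w hw (ε / 4) hε4
  obtain ⟨N₂, -, hfar⟩ := farField_tilt_sub_axis hS hrot hcont stub_tiltGeometry k ((m : ℝ) + 1) r (ε / 4) hr0 hε4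
  refine ⟨max (max N₁ N₂) 1, fun n hn => ?_⟩
  have hn1 : N₁ ≤ n := le_trans ((le_max_left _ _).trans (le_max_left _ _)) hn
  have hn2 : N₂ ≤ n := le_trans ((le_max_right _ _).trans (le_max_left _ _)) hn
  have hn0 : 1 ≤ n := le_trans (le_max_right _ _) hn
  have hnpos : (0:ℝ) < n := by exact_mod_cast (show 0 < n by omega)
  obtain ⟨hnearA, hnearT⟩ := hnear n hn1
  have hnearT' : (rhoPin (1 / (n : ℝ)) / (n : ℝ) ^ 3) ^ k *
      ∑ y ∈ (Fintype.piFinset (fun l => axisCell n (w l))).filter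
        (fun y => ∃ a b, a ≠ b ∧ ∀ i, |((y a i : ℤ) : ℝ) - ((y b i : ℤ) : ℝ)| < r * n),
        criticalCorr 3 k (fun l => psiInv (y l)) ≤ ε / 4 := by
    rw [sum_near_tilt_reindex n m w hw r (fun y => criticalCorr 3 k y)]; exact hnearT
  clear hnearT
  -- notation
  set sA := Fintype.piFinset (fun l => axisCell n (w l)) with hsA
  set Pn : (Fin k → Site 3) → Prop := fun y => ∃ a b, a ≠ b ∧ ∀ i, |((y a i : ℤ) : ℝ) - ((y b i : ℤ) : ℝ)| < r * n
    with hPn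
  set c : ℝ := (rhoPin (1 / (n : ℝ)) / (n : ℝ) ^ 3) ^ k with hc
  have hc0 : 0 ≤ c := pow_nonneg (div_nonneg (Real.rpow_nonneg (criticalTwoPoint_nonneg' _) _) (pow_nonneg hnpos.le 3)) k
  -- far part, termwise
  have hfar_term : ∀ y ∈ sA.filter (fun y => ¬ Pn y),
      |c * criticalCorr 3 k (fun l => psiInv (y l)) - c * criticalCorr 3 k y| ≤ ε / 4 / ((n : ℝ) ^ 3) ^ k := by
    intro y hy
    rw [Finset.mem_filter] at hy
    obtain ⟨hyA, hyfar⟩ := hy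
    rw [Fintype.mem_piFinset] at hyA
    have hwin : ∀ l i, |((y l i : ℤ) : ℝ)| ≤ ((m : ℝ) + 1) * n := fun l i => by
      have := abs_le_of_mem_axisCell (hw l) (hyA l) i
      have h' : ((|y l i| : ℤ) : ℝ) ≤ (((n : ℤ) * ((m : ℤ) + 1) : ℤ) : ℝ) := by exact_mod_cast this
      push_cast at h'
      linarith
    have hsep : ∀ l l', l ≠ l' → ∃ i, r * n ≤ |((y l i : ℤ) : ℝ) - ((y l' i : ℤ) : ℝ)| := by
      intro l l' hll
      by_contra hcon
      push Not at hcon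
      exact hyfar ⟨l, l', hll, hcon⟩
    have h := hfar n hn2 y hwin hsep
    -- `c = ρ^k / (n³)^k`
    have hcρ : c = rhoPin (1 / (n : ℝ)) ^ k / ((n : ℝ) ^ 3) ^ k := by rw [hc, div_pow]
    rw [hcρ, div_mul_eq_mul_div, div_mul_eq_mul_div, ← sub_div, abs_div,
      abs_of_pos (pow_pos (pow_pos hnpos 3) k)]
    exact div_le_div_of_nonneg_right h (pow_nonneg (pow_nonneg hnpos.le 3) k)
  have hcardA : (sA.card : ℝ) = ((n : ℝ) ^ 3) ^ k := by
    rw [hsA, Fintype.card_piFinset]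
    simp only [TiltGeometry.card_axisCell, Finset.prod_const, Finset.card_univ, Fintype.card_fin]
    push_cast
    ring
  have hfar : |∑ y ∈ sA.filter (fun y => ¬ Pn y), (c * criticalCorr 3 k (fun l => psiInv (y l)) - c * criticalCorr 3 k y)|
      ≤ ε / 4 := by
    refine (Finset.abs_sum_le_sum_abs _ _).trans ?_
    calc ∑ y ∈ sA.filter (fun y => ¬ Pn y), |c * criticalCorr 3 k (fun l => psiInv (y l)) - c * criticalCorr 3 k y|
        ≤ ∑ _y ∈ sA.filter (fun y => ¬ Pn y), ε / 4 / ((n : ℝ) ^ 3) ^ k := Finset.sum_le_sum hfar_term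
      _ = ((sA.filter (fun y => ¬ Pn y)).card : ℝ) * (ε / 4 / ((n : ℝ) ^ 3) ^ k) := by
          rw [Finset.sum_const, nsmul_eq_mul]
      _ ≤ (sA.card : ℝ) * (ε / 4 / ((n : ℝ) ^ 3) ^ k) :=
          mul_le_mul_of_nonneg_right (by exact_mod_cast Finset.card_filter_le _ _) (by positivity)
      _ = ε / 4 := by rw [hcardA]; field_simp
  -- near parts (both nonnegative and `≤ ε/4`)
  have hG0 : ∀ y : Fin k → Site 3, 0 ≤ criticalCorr 3 k y := fun y =>
    Summit.CriticalPhenomena.Ising3DConformalLimit.Theorems.GapForcesFarMerging.Negative.criticalCorr_nonneg' y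
  have hnA0 : 0 ≤ c * ∑ y ∈ sA.filter Pn, criticalCorr 3 k y :=
    mul_nonneg hc0 (Finset.sum_nonneg fun y _ => hG0 y)
  have hnT0 : 0 ≤ c * ∑ y ∈ sA.filter Pn, criticalCorr 3 k (fun l => psiInv (y l)) :=
    mul_nonneg hc0 (Finset.sum_nonneg fun y _ => hG0 _)
  have hnT : c * ∑ y ∈ sA.filter Pn, criticalCorr 3 k (fun l => psiInv (y l)) ≤ ε / 4 := hnearT'
  -- assemble
  rw [Real.dist_eq, sub_zero]
  have hsplit : c * ((∑ y ∈ sA, criticalCorr 3 k (fun l => psiInv (y l))) - ∑ y ∈ sA, criticalCorr 3 k y) =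
      (c * ∑ y ∈ sA.filter Pn, criticalCorr 3 k (fun l => psiInv (y l)) - c * ∑ y ∈ sA.filter Pn, criticalCorr 3 k y) +
        ∑ y ∈ sA.filter (fun y => ¬ Pn y), (c * criticalCorr 3 k (fun l => psiInv (y l)) - c * criticalCorr 3 k y) := by
    rw [← Finset.sum_filter_add_sum_filter_not sA Pn (fun y => criticalCorr 3 k (fun l => psiInv (y l))),
      ← Finset.sum_filter_add_sum_filter_not sA Pn (fun y => criticalCorr 3 k y), Finset.sum_sub_distrib,
      ← Finset.mul_sum, ← Finset.mul_sum]
    ring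
  rw [hsplit]
  calc |(c * ∑ y ∈ sA.filter Pn, criticalCorr 3 k (fun l => psiInv (y l)) - c * ∑ y ∈ sA.filter Pn, criticalCorr 3 k y) +
        ∑ y ∈ sA.filter (fun y => ¬ Pn y), (c * criticalCorr 3 k (fun l => psiInv (y l)) - c * criticalCorr 3 k y)|
      ≤ |c * ∑ y ∈ sA.filter Pn, criticalCorr 3 k (fun l => psiInv (y l)) - c * ∑ y ∈ sA.filter Pn, criticalCorr 3 k y| +
        |∑ y ∈ sA.filter (fun y => ¬ Pn y), (c * criticalCorr 3 k (fun l => psiInv (y l)) - c * criticalCorr 3 k y)| :=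
        abs_add_le _ _
    _ ≤ (ε / 4 + ε / 4) + ε / 4 := by
        refine add_le_add ?_ hfar
        rw [abs_le]
        constructor <;> linarith [hnearA, hnT, hnA0, hnT0]
    _ < ε := by linarith

end Summit.CriticalPhenomena.Ising3DConformalLimit.Cruxes.RotationJoining.RateSplitting

end
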